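import Literature.AlgebraicGeometry.AbelianSchemes.PolarizationOfLDeltaCubeLocus
import Literature.AlgebraicGeometry.AbelianSchemes.LDeltaCubeLocus
import Literature.AlgebraicGeometry.Modules.DetClassDual
import Literature.AlgebraicGeometry.Modules.DetClassTensor
import Literature.AlgebraicGeometry.Modules.CechPicOfLocalRing
import HarnessLib

/-!
# The (V) polarization closer, ampleness letters: the normalised bundle `L′ = L₀ ⊗ π^*(ε^*L₀)^∨` is fibrewise `L₀`

Layer `Literature/AlgebraicGeometry/AbelianSchemes`, namespace `Literature.AlgebraicGeometry.AbelianSchemes.AbelianSchemeOver`.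
THEOREMS ONLY (no definition, no named fact, no instance, no notation, no `sorry`).  Cell hodgecm-mathlib (D-0151), F-DAG leaf F-6 (V),
companion of ★ `PolarizationOfLDeltaCubeLocus` (B-p08 (g13) reader note (n1), B-plan1 (g16) F4, B-p02 (g14) letter 08:42:13Z).  HC_CM is
proved only modulo the 7 printed citations until rung 0 closes; nothing here is about HC.

★ (γ) `LDeltaCubeLocus.exists_classify_and_LDelta_cube_locus` works with the NORMALISED (rigidified) bundle
`L′ = L₀ ⊗ π^*(ε^*L₀)^∨` of [MumfordFogartyKirwan1994] Prop. 7.3 step (V) («`L′₄ = L₄ ⊗ π^*(ε^*L₄)⁻¹`»), while the Hilbert-scheme side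
holds ampleness for `L₀ = 𝒪(1)|_A` itself.  On every fibre the two agree: `Pic(Spec Ω) = 1` kills `s^*(ε^*L₀)^∨`.

* §1 `nonempty_iso_lineBundleOfDivisor_normalised` — `pr_s^*L₀ ≅ 𝒪(Θ)` ⇒ `pr_s^*L′ ≅ 𝒪(Θ)` (same `Θ`), at every field-valued point
  (classes in `Ȟ¹(A_s, 𝒪^×)`: `[pr_s^*L′] = [pr_s^*L₀] · π_s^*(s^*[(ε^*L₀)^∨]) = [pr_s^*L₀]`, ★ `CechPic.eq_one_of_isLocalRing`, ★
  `detClass_tensorObj_of_hasRank_one`, ★ `detClass_pullback`, ★ `nonempty_iso_iff_detClass_eq`);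
  `forall_exists_isAmple_iso_normalised` — the `hamp` letter of ★ `exists_polarization_lam_eq_of_LDelta_cube` for `L′` from the one for `L₀`.
* §2 **`exists_polarization_lam_eq_of_LDelta_cube_of_fibrewise_ample`** — THE CLOSER IN THE `L₀`-LETTER: ★ §6 of the companion with
  `L := L′` and `hamp` stated for `L₀` (the consumer feeds ★ (γ)'s `lam, hlam, ω₅, hω, Γ₁^*𝒫, hLM` for `L′` and the Hilbert-side ampleness of
  `L₀|_{A_s}` unchanged).

## References
* [MumfordFogartyKirwan1994] D. Mumford, J. Fogarty, F. Kirwan, *Geometric Invariant Theory*, 3rd ed. (1994), Ch. 6 §2 Def. 6.3 (p. 120),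
  Ch. 7 §2 Prop. 7.3 step (V) (p. 134).
* [Hartshorne1977] R. Hartshorne, *Algebraic Geometry* (1977), II §6 (p. 143), II Ex. 6.11, III Ex. 4.5.
-/

noncomputable section

universe u

open CategoryTheory CategoryTheory.Limits AlgebraicGeometry MonoidalCategory Cardinal

namespace Literature.AlgebraicGeometry.AbelianSchemes

open Literature.AlgebraicGeometry.Motives Literature.AlgebraicGeometry.AbelianVarieties Literature.AlgebraicGeometry.Modules
open scoped MonObj

namespace AbelianSchemeOver

variable {S : Scheme.{u}} (A : AbelianSchemeOver S) (D : A.DualPair) (L₀ : A.left.Modules) (hL₀ : HasRank L₀ 1)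
  {Ω : Type u} [Field Ω] (s : Spec (.of Ω) ⟶ S)

/-! ## §1 `L′ = L₀ ⊗ π^*(ε^*L₀)^∨` restricts to `L₀` on every fibre -/

include hL₀ in
/-- **The normalised bundle is fibrewise the original one**: if `pr_s^*L₀ ≅ 𝒪(Θ)` on the fibre `A_s` over a field-valued point `s`,
then `pr_s^*(L₀ ⊗ π^*(ε^*L₀)^∨) ≅ 𝒪(Θ)` for the SAME `Θ`.  In `Ȟ¹(A_s, 𝒪^×)`: `[pr_s^*L′] = [pr_s^*L₀]·pr_s^*π^*[(ε^*L₀)^∨]` (★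
`detClass_tensorObj_of_hasRank_one`, ★ `detClass_pullback`) and `pr_s ≫ π = π_s ≫ s` with `Ȟ¹(Spec Ω, 𝒪^×) = 1` (★
`CechPic.eq_one_of_isLocalRing`), so the twist dies; rank-one modules with equal classes are isomorphic (★ `nonempty_iso_iff_detClass_eq`).
[cite: MumfordFogartyKirwan1994, Ch. 7 §2 Prop. 7.3 step (V) (p. 134)] [cite: Hartshorne1977, II §6 (p. 143) and III Ex. 4.5] -/
theorem nonempty_iso_lineBundleOfDivisor_normalised {Θ : CartierDivisor (A.fibre s).toAbelianVariety.X.left}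
    (e : (Scheme.Modules.pullback (X := (A.fibre s).toAbelianVariety.X.left) (pullback.fst A.X.hom s)).obj L₀ ≅
      A.lineBundleOfDivisor s Θ) :
    Nonempty ((Scheme.Modules.pullback (X := (A.fibre s).toAbelianVariety.X.left) (pullback.fst A.X.hom s)).obj
      (tensorObj L₀ ((Scheme.Modules.pullback A.X.hom).obj
        (Modules.dual ((Scheme.Modules.pullback A.unitSection).obj L₀)))) ≅ A.lineBundleOfDivisor s Θ) := by
  have hNd : HasRank (Modules.dual ((Scheme.Modules.pullback A.unitSection).obj L₀)) 1 :=
    hasRank_dual (hasRank_pullback _ hL₀)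
  have hπN : HasRank ((Scheme.Modules.pullback A.X.hom).obj
      (Modules.dual ((Scheme.Modules.pullback A.unitSection).obj L₀))) 1 := hasRank_pullback _ hNd
  have hL' : HasRank (tensorObj L₀ ((Scheme.Modules.pullback A.X.hom).obj
      (Modules.dual ((Scheme.Modules.pullback A.unitSection).obj L₀)))) 1 := hasRank_tensorObj_one hL₀ hπN
  refine (nonempty_iso_iff_detClass_eq (hasRank_pullback _ hL') (A.hasRank_lineBundleOfDivisor s Θ)
    ((HasRank.isFiniteLocallyFree' hL').pullback _) Θ.toUnitCocycle.isFiniteLocallyFree_lineBundle).2 ?_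
  -- the class of `pr_s^*L₀` is `[Θ]`
  have h₀ : CechPic.pullback (X := (A.fibre s).toAbelianVariety.X.left) (pullback.fst A.X.hom s)
      (detClass (HasRank.isFiniteLocallyFree' hL₀)) = Θ.cechClass := A.cechPic_pullback_fst_detClass_eq_of_iso s hL₀ e
  -- the class of `pr_s^*π^*N^∨` is trivial: `pr_s ≫ π = π_s ≫ s` and `Pic(Spec Ω) = 1`
  have h₁ : CechPic.pullback (X := (A.fibre s).toAbelianVariety.X.left) (pullback.fst A.X.hom s)
      (detClass (HasRank.isFiniteLocallyFree' hπN)) = 1 := by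
    -- computed on `pullback A.X.hom s` (the fibre scheme, syntactically), then transported by `exact`
    have h₁' : CechPic.pullback (pullback.fst A.X.hom s) (detClass (HasRank.isFiniteLocallyFree' hπN)) = 1 := by
      rw [detClass_pullback A.X.hom (HasRank.isFiniteLocallyFree' hNd), ← CechPic.pullback_comp, pullback.condition,
        CechPic.pullback_comp, CechPic.eq_one_of_isLocalRing (CechPic.pullback s _), map_one]
    exact h₁'
  rw [detClass_lineBundle_toUnitCocycle, detClass_pullback _ (HasRank.isFiniteLocallyFree' hL'),
    detClass_tensorObj_of_hasRank_one hL₀ hπN (HasRank.isFiniteLocallyFree' hL₀) (HasRank.isFiniteLocallyFree' hπN)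
      (HasRank.isFiniteLocallyFree' hL'), map_mul, h₀, h₁, mul_one]

include hL₀ in
/-- **The `hamp` letter for `L′` from the one for `L₀`**: if at every geometric point `L₀|_{A_s} ≅ 𝒪(Θ)` with `Θ` ample, then the same
holds for the normalised `L′ = L₀ ⊗ π^*(ε^*L₀)^∨` (same `Θ`). [cite: MumfordFogartyKirwan1994, Ch. 7 §2 Prop. 7.3 step (V) (p. 134)]
[cite: Hartshorne1977, III Ex. 4.5] -/
theorem forall_exists_isAmple_iso_normalised
    (hamp : ∀ ⦃Ω : Type u⦄ [Field Ω] [IsAlgClosed Ω] (s : Spec (.of Ω) ⟶ S),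
      ∃ Θ : CartierDivisor (A.fibre s).toAbelianVariety.X.left, Θ.IsAmple ∧
        Nonempty ((Scheme.Modules.pullback (X := (A.fibre s).toAbelianVariety.X.left) (pullback.fst A.X.hom s)).obj L₀ ≅
          A.lineBundleOfDivisor s Θ))
    ⦃Ω : Type u⦄ [Field Ω] [IsAlgClosed Ω] (s : Spec (.of Ω) ⟶ S) :
    ∃ Θ : CartierDivisor (A.fibre s).toAbelianVariety.X.left, Θ.IsAmple ∧
      Nonempty ((Scheme.Modules.pullback (X := (A.fibre s).toAbelianVariety.X.left) (pullback.fst A.X.hom s)).obj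
        (tensorObj L₀ ((Scheme.Modules.pullback A.X.hom).obj
          (Modules.dual ((Scheme.Modules.pullback A.unitSection).obj L₀)))) ≅ A.lineBundleOfDivisor s Θ) := by
  obtain ⟨Θ, hΘ, ⟨e⟩⟩ := hamp s
  exact ⟨Θ, hΘ, A.nonempty_iso_lineBundleOfDivisor_normalised L₀ hL₀ s e⟩

/-! ## §2 The closer in the `L₀`-letter -/

/-- **THE (V) POLARIZATION CLOSER, `L₀`-LETTER** ([MumfordFogartyKirwan1994] Prop. 7.3 step (V)): as ★
`exists_polarization_lam_eq_of_LDelta_cube`, with the classifying homomorphism `lam`, the relation `[6] ≫ ω = lam ×_S T` and the cube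
isomorphism `L′|_{A_T} ≅ M^{⊗3}` all for the NORMALISED `L′ = L₀ ⊗ π^*(ε^*L₀)^∨` (★ (γ)'s letter, `HasRank L′ 1` by ★ `hasRank_normalised`),
but the fibrewise AMPLENESS stated for `L₀` (the Hilbert side's `𝒪(1)|_A`): **`∃ pol : (A.baseChange b).Polarization (D.baseChange b),
pol.lam = ω`**. [cite: MumfordFogartyKirwan1994, Ch. 7 §2 Prop. 7.3 step (V) (p. 134)] [cite: MumfordFogartyKirwan1994, Ch. 6 §2 Definition 6.3 (p. 120)] -/
theorem exists_polarization_lam_eq_of_LDelta_cube_of_fibrewise_ample {F : Type} [Field F] [CharZero F] (hF : #F ≤ ℵ₀)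
    {S T : Scheme.{0}} (f : S ⟶ Spec (.of F)) [LocallyOfFiniteType f] (A : AbelianSchemeOver S) (D : A.DualPair)
    (hD : Nonempty ((Scheme.Modules.pullback (DualPair.unitHatSlice D)).obj D.P ≅ SheafOfModules.unit _))
    {g : ℕ} (hA : A.IsOfRelDim g) (L₀ : A.left.Modules) (hL₀ : HasRank L₀ 1)
    (lam : A.X ⟶ D.hat.X) [IsMonHom lam]
    (hlam : ∀ ⦃U : Over S⦄ (u : U ⟶ A.X),
      Nonempty ((Scheme.Modules.pullback (A.X ◁ (u ≫ lam)).left).obj D.P ≅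
        (Scheme.Modules.pullback (A.X ◁ u).left).obj (A.mumfordBundle
          (tensorObj L₀ ((Scheme.Modules.pullback A.X.hom).obj
            (Modules.dual ((Scheme.Modules.pullback A.unitSection).obj L₀)))))))
    (hamp : ∀ ⦃Ω : Type⦄ [Field Ω] [IsAlgClosed Ω] (s : Spec (.of Ω) ⟶ S),
      ∃ Θ : CartierDivisor (A.fibre s).toAbelianVariety.X.left, Θ.IsAmple ∧
        Nonempty ((Scheme.Modules.pullback (X := (A.fibre s).toAbelianVariety.X.left) (pullback.fst A.X.hom s)).obj L₀ ≅
          A.lineBundleOfDivisor s Θ))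
    (b : T ⟶ S) (ω : (A.baseChange b).X ⟶ (D.hat.baseChange b).X) [IsMonHom ω]
    (hω : ((𝟙 (A.baseChange b).X) ^ 6) ≫ ω = (Over.pullback b).map lam)
    {M : (A.baseChange b).left.Modules} (hM : HasRank M 1)
    (hLM : Nonempty ((Scheme.Modules.pullback (pullback.fst A.X.hom b)).obj
      (tensorObj L₀ ((Scheme.Modules.pullback A.X.hom).obj
        (Modules.dual ((Scheme.Modules.pullback A.unitSection).obj L₀)))) ≅ tensorPow M 3)) :
    ∃ pol : (A.baseChange b).Polarization (D.baseChange b), pol.lam = ω :=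
  AbelianSchemeOver.exists_polarization_lam_eq_of_LDelta_cube hF f A D hD hA (A.hasRank_normalised L₀ hL₀) lam hlam
    (A.forall_exists_isAmple_iso_normalised L₀ hL₀ hamp) b ω hω hM hLM

end AbelianSchemeOver

end Literature.AlgebraicGeometry.AbelianSchemes
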